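import Summits.AtomisticToContinuum.FouriersLaw.Theorems.BondHeatUncertaintySubdiffusiveBondHeatKernelGibbsF
import Summits.AtomisticToContinuum.FouriersLaw.Theorems.BondHeatUncertaintySubdiffusiveBondHeatSiteEnergyDynkinTruncation
import Mathlib.MeasureTheory.Function.L2Space
import Mathlib.Topology.UniformSpace.UniformApproximation
import HarnessLib

/-!
# Clausius budget, part 2: kinetics of the window response `k_t = ∫₀ᵗ P_s g ds` (equilibrium kernels)

Support file for crux `stmt-AtomisticToContinuum-9121` (`BondHeatUncertainty.ExtensiveSnapshotIrreversibility`),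
line `clausius-budget-sound-window`, stub `stub_clausiusBudget`. Pinned anharmonic chain
`P = pinnedChain ω₂ lam β γ` (`ω₂ > 0`, `lam ≥ 0`, `β, γ > 0`, `N ≥ 1`), both baths at `T > 0`, kernels
`P_t = P.transitionKernel N T T t`, Gibbs state `μ_T`; a NICE observable is a continuous `g` with
`|g| ≤ M e^{ϑH}`, `0 < ϑ`, `2ϑ < 1/T`. Proved here (unconditionally): `pinnedChain_exists_act_bound`
(`|P_s g| ≤ C e^{ϑH}` uniformly in `s`, from CEHR (2.5)); `pinnedChain_continuous_act_time_of_exp` (TIME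
CONTINUITY of `s ↦ P_s g(z)` for nice unbounded `g`: bounded energy truncations `gχ(H/R)` converge locally
uniformly in `s` by the moment bound (3.4)); `pinnedChain_integral_sq_act_le_of_stronglyMeasurable` (the
`L²(μ_T)` contraction for measurable `f = O(e^{ϑH})`); `pinnedChain_act_window` (the SEMIGROUP IDENTITY
`P_s k_t = k_{s+t} - k_s` of the window response, with its bounds, measurability and `k_t ∈ L²(μ_T)`).
Reference: Cuneo–Eckmann–Hairer–Rey-Bellet, EJP 23 (2018) no. 55, Thm 2.13 (3), §3 (3.4). No definitions;
nothing here closes an item.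
-/

noncomputable section

namespace Summit.AtomisticToContinuum.FouriersLaw.Theorems.ExtensiveSnapshotIrreversibility.ClausiusBudget

open MeasureTheory ProbabilityTheory Filter Topology Set
open scoped ENNReal NNReal
open Literature.MathematicalPhysics.KineticTheory.HeatConduction
open Literature.MathematicalPhysics.KineticTheory
open Summit.AtomisticToContinuum.FouriersLaw.Theorems.SubdiffusiveBondHeat

variable {N : ℕ}

section Pinned

variable {ω₂ lam β γ : ℝ} (hω : 0 < ω₂) (hl : 0 ≤ lam) (hβ : 0 < β) (hγ : 0 < γ) (hN : 0 < N)
  {T : ℝ} (hT : 0 < T)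
include hω hl hβ hγ hN hT

/-! ### Nice observables: a uniform bound on `P_s g`, joint measurability -/

/-- **Uniform bound**: for continuous `|g| ≤ M e^{ϑH}` (`0 < ϑ < 1/T`) there is `C ≥ 0` with
`|P_s g(z)| ≤ C e^{ϑH(z)}` for all `s ≥ 0`, `z` (exponential convergence to `μ_T(g)`, CEHR (2.5)).
[cite: CuneoEckmannHairerReyBellet2018, Thm 2.13 (3)] -/
theorem pinnedChain_exists_act_bound {ϑ M : ℝ} (hϑ : 0 < ϑ) (hϑ1 : ϑ < 1 / T) (hM : 0 ≤ M)
    {g : PhaseSpace N → ℝ} (hg : Continuous g)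
    (hgM : ∀ y, |g y| ≤ M * Real.exp (ϑ * (pinnedChain ω₂ lam β γ).hamiltonian N y)) :
    ∃ C : ℝ, 0 ≤ C ∧ ∀ (s : ℝ≥0) (z : PhaseSpace N),
      |∫ y, g y ∂((pinnedChain ω₂ lam β γ).transitionKernel N T T s z)| ≤
        C * Real.exp (ϑ * (pinnedChain ω₂ lam β γ).hamiltonian N z) := by
  set P := pinnedChain ω₂ lam β γ with hP
  obtain ⟨C₀, c, hC₀, hc, hb⟩ := pinnedChain_exp_convergence_gibbs hω hl hβ hγ hN hT hϑ hϑ1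
  set f : PhaseSpace N → ℝ := fun y => g y / (M + 1) with hf
  have hM1 : 0 < M + 1 := by linarith
  have hfb : ∀ y, |f y| ≤ Real.exp (ϑ * P.hamiltonian N y) := fun y => by
    rw [hf]
    simp only
    rw [abs_div, abs_of_pos hM1, div_le_iff₀ hM1]
    have := hgM y
    nlinarith [Real.exp_pos (ϑ * P.hamiltonian N y)]
  set m : ℝ := ∫ y, f y ∂(P.gibbsMeasure N T) with hm
  refine ⟨(M + 1) * (|m| + C₀), by positivity, fun s z => ?_⟩
  have h1 := hb z s f (hg.div_const _) hfb
  have hE : 1 ≤ Real.exp (ϑ * P.hamiltonian N z) :=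
    Real.one_le_exp (mul_nonneg hϑ.le (pinnedChain_hamiltonian_nonneg hω.le hl hβ.le γ N z))
  have hct : Real.exp (-c * s) ≤ 1 := Real.exp_le_one_iff.2 (by have : (0 : ℝ) ≤ s := s.coe_nonneg; nlinarith)
  have h2 : |∫ y, f y ∂(P.transitionKernel N T T s z)| ≤ (|m| + C₀) * Real.exp (ϑ * P.hamiltonian N z) := by
    have h3 := abs_sub_abs_le_abs_sub (∫ y, f y ∂(P.transitionKernel N T T s z)) m
    have h4 : C₀ * Real.exp (ϑ * P.hamiltonian N z) * Real.exp (-c * s) ≤ C₀ * Real.exp (ϑ * P.hamiltonian N z) := by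
      have : 0 ≤ C₀ * Real.exp (ϑ * P.hamiltonian N z) := by positivity
      nlinarith
    nlinarith [abs_nonneg m]
  have heq : ∫ y, g y ∂(P.transitionKernel N T T s z) = (M + 1) * ∫ y, f y ∂(P.transitionKernel N T T s z) := by
    rw [← integral_const_mul]
    exact integral_congr_ae (Eventually.of_forall fun y => by rw [hf]; simp only; field_simp)
  rw [heq, abs_mul, abs_of_pos hM1, mul_assoc]
  exact mul_le_mul_of_nonneg_left h2 hM1.le

/-! ### Time continuity of `s ↦ P_s g(z)` for nice `g` -/

omit hω hl hβ hγ hN hT in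
/-- Pointwise size of the truncation error: for `R > 0` and `|g| ≤ M e^{ϑH}`,
`|g - g χ(H/R)| ≤ M e^{-ϑR} e^{2ϑH}` (`χ = smoothCutoff` is `1` on `{H ≤ R}`). [folklore] -/
theorem abs_sub_mul_smoothCutoff_le {ϑ M : ℝ} (hϑ : 0 ≤ ϑ) (hM : 0 ≤ M) {g : PhaseSpace N → ℝ}
    (hgM : ∀ y, |g y| ≤ M * Real.exp (ϑ * (pinnedChain ω₂ lam β γ).hamiltonian N y)) {R : ℝ} (hR : 0 < R)
    (y : PhaseSpace N) :
    |g y - g y * smoothCutoff ((pinnedChain ω₂ lam β γ).hamiltonian N y / R)| ≤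
      M * Real.exp (-(ϑ * R)) * Real.exp (2 * ϑ * (pinnedChain ω₂ lam β γ).hamiltonian N y) := by
  set Hy := (pinnedChain ω₂ lam β γ).hamiltonian N y with hHy
  by_cases hle : Hy ≤ R
  · have : smoothCutoff (Hy / R) = 1 := smoothCutoff_of_le_one ((div_le_one hR).2 hle)
    rw [this, mul_one, sub_self, abs_zero]; positivity
  · push Not at hle
    have hχ0 : 0 ≤ smoothCutoff (Hy / R) := smoothCutoff_nonneg _
    have hχ1 : smoothCutoff (Hy / R) ≤ 1 := smoothCutoff_le_one _
    have h1 : |g y - g y * smoothCutoff (Hy / R)| ≤ |g y| := by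
      rw [show g y - g y * smoothCutoff (Hy / R) = g y * (1 - smoothCutoff (Hy / R)) by ring, abs_mul,
        abs_of_nonneg (show (0 : ℝ) ≤ 1 - smoothCutoff (Hy / R) by linarith)]
      nlinarith [abs_nonneg (g y)]
    have h2 : Real.exp (ϑ * Hy) ≤ Real.exp (-(ϑ * R)) * Real.exp (2 * ϑ * Hy) := by
      rw [← Real.exp_add]
      exact Real.exp_le_exp.2 (by nlinarith)
    calc |g y - g y * smoothCutoff (Hy / R)| ≤ |g y| := h1
      _ ≤ M * Real.exp (ϑ * Hy) := hgM y
      _ ≤ M * (Real.exp (-(ϑ * R)) * Real.exp (2 * ϑ * Hy)) := mul_le_mul_of_nonneg_left h2 hM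
      _ = _ := by ring

/-- **Time continuity of `P_s g` for nice `g`.** For continuous `g` with `|g| ≤ M e^{ϑH}`, `0 < ϑ`,
`2ϑ < 1/T`, and every `z`, `s ↦ ∫ g dP_{s⁺}(z, ·)` is continuous on `ℝ`: the truncations `g χ(H/R)` are
bounded continuous, so `s ↦ P_s(gχ_R)(z)` is continuous (dominated convergence along the continuous flow), and
`|P_s g(z) - P_s(gχ_R)(z)| ≤ M e^{-ϑR} E_z e^{2ϑH(z_s)} ≤ M e^{-ϑR} e^{4ϑγTs} e^{2ϑH(z)}` (CEHR (3.4)) tends to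
`0` locally uniformly in `s`. [cite: CuneoEckmannHairerReyBellet2018, §3 eq. (3.4)] -/
theorem pinnedChain_continuous_act_time_of_exp {ϑ M : ℝ} (hϑ : 0 < ϑ) (h2ϑ : 2 * ϑ < 1 / T) (hM : 0 ≤ M)
    {g : PhaseSpace N → ℝ} (hg : Continuous g)
    (hgM : ∀ y, |g y| ≤ M * Real.exp (ϑ * (pinnedChain ω₂ lam β γ).hamiltonian N y)) (z : PhaseSpace N) :
    Continuous fun s : ℝ => ∫ y, g y ∂((pinnedChain ω₂ lam β γ).transitionKernel N T T s.toNNReal z) := by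
  set P := pinnedChain ω₂ lam β γ with hP
  set H := P.hamiltonian N with hH
  set κ := P.transitionKernel N T T with hκ
  have hϑ1 : ϑ < 1 / T := by linarith
  have h2ϑ0 : 0 < 2 * ϑ := by positivity
  have hHc : Continuous H := pinnedChain_continuous_hamiltonian ω₂ lam β γ N
  set F : ℝ → ℝ → ℝ := fun R s => ∫ y, g y * smoothCutoff (H y / R) ∂(κ s.toNNReal z) with hF
  set f : ℝ → ℝ := fun s => ∫ y, g y ∂(κ s.toNNReal z) with hf
  -- the truncations are bounded continuous, hence `F R` is continuous in `s`
  have hFc : ∀ R : ℝ, 0 < R → Continuous (F R) := by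
    intro R hR
    have hgc : Continuous fun y => g y * smoothCutoff (H y / R) :=
      hg.mul (contDiff_smoothCutoff (n := 0) |>.continuous.comp (hHc.div_const R))
    have hbd : ∀ y, ‖g y * smoothCutoff (H y / R)‖ ≤ M * Real.exp (ϑ * (2 * R)) := by
      intro y
      rw [Real.norm_eq_abs, abs_mul, abs_of_nonneg (smoothCutoff_nonneg _)]
      by_cases hy : H y ≤ 2 * R
      · calc |g y| * smoothCutoff (H y / R) ≤ M * Real.exp (ϑ * H y) * 1 :=
              mul_le_mul (hgM y) (smoothCutoff_le_one _) (smoothCutoff_nonneg _) (by positivity)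
          _ ≤ M * Real.exp (ϑ * (2 * R)) := by
              rw [mul_one]
              exact mul_le_mul_of_nonneg_left (Real.exp_le_exp.2 (by nlinarith)) hM
      · push Not at hy
        have : smoothCutoff (H y / R) = 0 := smoothCutoff_of_two_le (by rw [le_div_iff₀ hR]; linarith)
        rw [this, mul_zero]; positivity
    exact pinnedChain_continuous_integral_transitionKernel_time hω hl hβ hγ hgc hbd z
  -- integrability against the kernels
  have hVint : ∀ (s : ℝ), Integrable (fun y => Real.exp (2 * ϑ * H y)) (κ s.toNNReal z) := fun s =>
    pinnedChain_integrable_exp_mul_hamiltonian_transitionKernel hω hl hT hβ.le hγ.le hN h2ϑ0 h2ϑ _ z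
  have hgint : ∀ s : ℝ, Integrable g (κ s.toNNReal z) := fun s =>
    integrable_of_abs_le_exp
      (pinnedChain_integrable_exp_mul_hamiltonian_transitionKernel hω hl hT hβ.le hγ.le hN hϑ hϑ1 _ z) hg hgM
  have hgRint : ∀ (R : ℝ) (s : ℝ), Integrable (fun y => g y * smoothCutoff (H y / R)) (κ s.toNNReal z) := by
    intro R s
    refine (hgint s).norm.mono' (hg.mul (contDiff_smoothCutoff (n := 0) |>.continuous.comp
      (hHc.div_const R))).aestronglyMeasurable (Eventually.of_forall fun y => ?_)
    rw [Real.norm_eq_abs, abs_mul, abs_of_nonneg (smoothCutoff_nonneg _)]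
    calc |g y| * smoothCutoff (H y / R) ≤ |g y| * 1 :=
          mul_le_mul_of_nonneg_left (smoothCutoff_le_one _) (abs_nonneg _)
      _ = ‖g y‖ := by rw [mul_one, Real.norm_eq_abs]
  -- the truncation error, uniformly on bounded time intervals
  have herr : ∀ (R : ℝ), 0 < R → ∀ (b s : ℝ), s ≤ b →
      dist (f s) (F R s) ≤ M * Real.exp (-(ϑ * R)) *
        (Real.exp (2 * ϑ * γ * (T + T) * max b 0) * Real.exp (2 * ϑ * H z)) := by
    intro R hR b s hs
    rw [Real.dist_eq, hf, hF]
    simp only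
    rw [← integral_sub (hgint s) (hgRint R s)]
    have h34 := pinnedChain_integral_exp_mul_hamiltonian_transitionKernel_le hω hl hβ hγ hN hT h2ϑ0 h2ϑ
      s.toNNReal z
    have hs' : ((s.toNNReal : ℝ≥0) : ℝ) ≤ max b 0 := by
      rcases le_or_gt 0 s with h0 | h0
      · rw [Real.coe_toNNReal _ h0]; exact le_trans hs (le_max_left _ _)
      · rw [Real.toNNReal_of_nonpos h0.le]; simp
    calc |∫ y, (g y - g y * smoothCutoff (H y / R)) ∂(κ s.toNNReal z)|
        ≤ ∫ y, |g y - g y * smoothCutoff (H y / R)| ∂(κ s.toNNReal z) := abs_integral_le_integral_abs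
      _ ≤ ∫ y, M * Real.exp (-(ϑ * R)) * Real.exp (2 * ϑ * H y) ∂(κ s.toNNReal z) :=
          integral_mono ((hgint s).sub (hgRint R s)).abs ((hVint s).const_mul _) fun y =>
            abs_sub_mul_smoothCutoff_le (ω₂ := ω₂) (lam := lam) (β := β) (γ := γ) hϑ.le hM hgM hR y
      _ = M * Real.exp (-(ϑ * R)) * ∫ y, Real.exp (2 * ϑ * H y) ∂(κ s.toNNReal z) := integral_const_mul _ _
      _ ≤ M * Real.exp (-(ϑ * R)) * (Real.exp (2 * ϑ * γ * (T + T) * (s.toNNReal : ℝ)) *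
            Real.exp (2 * ϑ * H z)) := mul_le_mul_of_nonneg_left h34 (by positivity)
      _ ≤ M * Real.exp (-(ϑ * R)) * (Real.exp (2 * ϑ * γ * (T + T) * max b 0) * Real.exp (2 * ϑ * H z)) := by
          gcongr
  -- continuity on every bounded open interval, by uniform approximation
  have hcont : ∀ a b : ℝ, ContinuousOn f (Ioo a b) := by
    intro a b
    set B : ℝ := Real.exp (2 * ϑ * γ * (T + T) * max b 0) * Real.exp (2 * ϑ * H z) with hB
    have hlim : Tendsto (fun R : ℝ => M * Real.exp (-(ϑ * R)) * B) atTop (𝓝 0) := by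
      have h1 : Tendsto (fun R : ℝ => Real.exp (-(ϑ * R))) atTop (𝓝 0) :=
        (Real.tendsto_exp_neg_atTop_nhds_zero.comp (tendsto_id.const_mul_atTop hϑ)).congr fun R => by simp
      simpa using (h1.const_mul M).mul_const B
    have hunif : TendstoUniformlyOn F f atTop (Ioo a b) := by
      rw [Metric.tendstoUniformlyOn_iff]
      intro ε hε
      filter_upwards [hlim.eventually (gt_mem_nhds hε), eventually_gt_atTop (0 : ℝ)] with R hR hR0 s hs
      exact lt_of_le_of_lt (herr R hR0 b s hs.2.le) hR
    exact hunif.continuousOn (Eventually.mono (eventually_gt_atTop (0 : ℝ)) fun R hR =>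
      (hFc R hR).continuousOn).frequently
  exact continuous_iff_continuousAt.2 fun s => (hcont (s - 1) (s + 1)).continuousAt (Ioo_mem_nhds (by linarith) (by linarith))

/-! ### The `L²(μ_T)` contraction for measurable observables -/

/-- **`L²(μ_T)`-contraction of the transition kernels** for strongly measurable `f` with `|f| ≤ C e^{ϑH}`
(`0 < ϑ`, `2ϑ < 1/T`): `(P_u f)² ∈ L¹(μ_T)` and `∫ (P_u f)² dμ_T ≤ ∫ f² dμ_T` (Jensen for the Markov kernel
and kernel Gibbs invariance). [folklore] -/
theorem pinnedChain_integral_sq_act_le_of_stronglyMeasurable {ϑ C : ℝ} (hϑ0 : 0 < ϑ) (h2ϑ : 2 * ϑ < 1 / T)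
    {f : PhaseSpace N → ℝ} (hf : StronglyMeasurable f)
    (hfb : ∀ y, |f y| ≤ C * Real.exp (ϑ * (pinnedChain ω₂ lam β γ).hamiltonian N y)) (u : ℝ≥0) :
    Integrable (fun y => f y ^ 2) ((pinnedChain ω₂ lam β γ).gibbsMeasure N T) ∧
    Integrable (fun z => (∫ y, f y ∂((pinnedChain ω₂ lam β γ).transitionKernel N T T u z)) ^ 2)
      ((pinnedChain ω₂ lam β γ).gibbsMeasure N T) ∧
    ∫ z, (∫ y, f y ∂((pinnedChain ω₂ lam β γ).transitionKernel N T T u z)) ^ 2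
        ∂((pinnedChain ω₂ lam β γ).gibbsMeasure N T) ≤
      ∫ z, f z ^ 2 ∂((pinnedChain ω₂ lam β γ).gibbsMeasure N T) := by
  -- adapted from `SubdiffusiveBondHeat.pinnedChain_integral_sq_act_le` (continuity replaced by measurability)
  set P := pinnedChain ω₂ lam β γ with hP
  set μ := P.gibbsMeasure N T with hμ
  set κ := P.transitionKernel N T T u with hκ
  haveI : IsProbabilityMeasure μ := pinnedChain_isProbabilityMeasure_gibbsMeasure hω hl hβ.le γ N hT
  haveI : IsMarkovKernel κ := pinnedChain_isMarkovKernel_transitionKernel hω hl hβ.le hγ.le N T T u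
  have hϑ1 : ϑ < 1 / T := by linarith
  have h2ϑ0 : 0 < 2 * ϑ := by positivity
  have hf2b : ∀ y, |f y ^ 2| ≤ C ^ 2 * Real.exp (2 * ϑ * P.hamiltonian N y) := fun y => by
    rw [abs_pow, show C ^ 2 * Real.exp (2 * ϑ * P.hamiltonian N y) =
      (C * Real.exp (ϑ * P.hamiltonian N y)) ^ 2 by rw [mul_pow, ← Real.exp_nat_mul]; ring_nf]
    exact pow_le_pow_left₀ (abs_nonneg _) (hfb y) 2
  have hmono : ∀ {ν : Measure (PhaseSpace N)} {θ K : ℝ} {h : PhaseSpace N → ℝ},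
      Integrable (fun y => Real.exp (θ * P.hamiltonian N y)) ν → AEStronglyMeasurable h ν →
      (∀ y, |h y| ≤ K * Real.exp (θ * P.hamiltonian N y)) → Integrable h ν :=
    fun hint hh hle => (hint.const_mul _).mono' hh (Eventually.of_forall fun y => by
      rw [Real.norm_eq_abs]; exact hle y)
  have hfκ : ∀ z, Integrable f (κ z) := fun z => hmono
    (pinnedChain_integrable_exp_mul_hamiltonian_transitionKernel hω hl hT hβ.le hγ.le hN hϑ0 hϑ1 u z)
    hf.aestronglyMeasurable hfb
  have hf2κ : ∀ z, Integrable (fun y => f y ^ 2) (κ z) := fun z => hmono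
    (pinnedChain_integrable_exp_mul_hamiltonian_transitionKernel hω hl hT hβ.le hγ.le hN h2ϑ0 h2ϑ u z)
    (hf.aestronglyMeasurable.pow 2) hf2b
  have hf2μ : Integrable (fun y => f y ^ 2) μ := hmono
    (pinnedChain_integrable_exp_mul_hamiltonian_gibbsMeasure hω hl hβ.le γ N hT h2ϑ)
    (hf.aestronglyMeasurable.pow 2) hf2b
  set g : PhaseSpace N → ℝ := fun z => ∫ y, f y ∂(κ z) with hg
  have hgm : StronglyMeasurable g := hf.integral_kernel (κ := κ)
  have hjensen : ∀ z, g z ^ 2 ≤ ∫ y, f y ^ 2 ∂(κ z) := by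
    intro z
    have hvar : 0 ≤ ∫ y, (f y - g z) ^ 2 ∂(κ z) := integral_nonneg fun y => sq_nonneg _
    have hexp : ∫ y, (f y - g z) ^ 2 ∂(κ z) = (∫ y, f y ^ 2 ∂(κ z)) - g z ^ 2 := by
      have e : (fun y => (f y - g z) ^ 2) = fun y => f y ^ 2 - (2 * g z) * f y + g z ^ 2 := by
        funext y; ring
      have i1 : Integrable (fun y => f y ^ 2 - 2 * g z * f y) (κ z) := (hf2κ z).sub ((hfκ z).const_mul _)
      rw [e, integral_add i1 (integrable_const _), integral_sub (hf2κ z) ((hfκ z).const_mul _),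
        integral_const_mul, integral_const]
      simp only [probReal_univ, smul_eq_mul, one_mul]
      rw [show (∫ y, f y ∂(κ z)) = g z from rfl]
      ring
    linarith
  have hP2val : ∫ z, (∫ y, f y ^ 2 ∂(κ z)) ∂μ = ∫ z, f z ^ 2 ∂μ :=
    pinnedChain_integral_transitionKernel_gibbsMeasure hω hl hβ.le hγ.le hN hT u hf2μ
  have hinv := pinnedChain_gibbsMeasure_bind_transitionKernel hω hl hβ.le hγ.le hN hT u
  have h' : (κ ∘ₖ Kernel.const Unit μ) () = μ := by rw [← Measure.comp_eq_comp_const_apply]; exact hinv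
  have hf2' : Integrable (fun y => f y ^ 2) ((κ ∘ₖ Kernel.const Unit μ) ()) := by rw [h']; exact hf2μ
  have hP2int : Integrable (fun z => ∫ y, f y ^ 2 ∂(κ z)) μ := by
    have := hf2'.integral_comp
    rwa [Kernel.const_apply] at this
  have hg2int : Integrable (fun z => g z ^ 2) μ :=
    hP2int.mono' (hgm.measurable.pow_const 2).aestronglyMeasurable (Eventually.of_forall fun z => by
      rw [Real.norm_eq_abs, abs_of_nonneg (sq_nonneg _)]; exact hjensen z)
  exact ⟨hf2μ, hg2int, hP2val ▸
    integral_mono_of_nonneg (Eventually.of_forall fun z => sq_nonneg _) hP2int (Eventually.of_forall hjensen)⟩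

/-! ### The window response `k_t = ∫₀ᵗ P_s g ds`: bounds, measurability, the semigroup identity -/

/-- **Kinetics of the window response.** For a nice continuous `g` (`|g| ≤ M e^{ϑH}`, `0 < ϑ`, `2ϑ < 1/T`),
with `Pg s z = P_{s⁺} g(z)` and `k t z = ∫₀ᵗ Pg s z ds` (given by their defining equations): `s ↦ Pg s z` is
continuous; `|Pg s z| ≤ C e^{ϑH(z)}` for a constant `C ≥ 0`; `(s, z) ↦ Pg s z` is jointly measurable;
`|k t z| ≤ t C e^{ϑH(z)}` and `k t` is measurable and in `L²(μ_T)` for `t ≥ 0`; and the **semigroup identity**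
`∫ k t dP_s(z, ·) = k (s + t) z - k s z` for `s, t ≥ 0` (Fubini on `[0,t] × P_s(z,·)` and Chapman–Kolmogorov
`P_s P_u = P_{u+s}`). [cite: CuneoEckmannHairerReyBellet2018, §3 eq. (3.4)] -/
theorem pinnedChain_act_window {ϑ M : ℝ} (hϑ : 0 < ϑ) (h2ϑ : 2 * ϑ < 1 / T) (hM : 0 ≤ M)
    {g : PhaseSpace N → ℝ} (hg : Continuous g)
    (hgM : ∀ y, |g y| ≤ M * Real.exp (ϑ * (pinnedChain ω₂ lam β γ).hamiltonian N y))
    (Pg : ℝ → PhaseSpace N → ℝ)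
    (hPg : Pg = fun s z => ∫ y, g y ∂((pinnedChain ω₂ lam β γ).transitionKernel N T T s.toNNReal z))
    (k : ℝ → PhaseSpace N → ℝ) (hk : k = fun τ z => ∫ s in (0 : ℝ)..τ, Pg s z) :
    (∀ z, Continuous fun s => Pg s z) ∧
    (∃ C : ℝ, 0 ≤ C ∧ (∀ s z, |Pg s z| ≤ C * Real.exp (ϑ * (pinnedChain ω₂ lam β γ).hamiltonian N z)) ∧
      ∀ t : ℝ, 0 ≤ t → ∀ z, |k t z| ≤ t * C * Real.exp (ϑ * (pinnedChain ω₂ lam β γ).hamiltonian N z)) ∧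
    StronglyMeasurable (Function.uncurry Pg) ∧
    (∀ t : ℝ, 0 ≤ t → StronglyMeasurable (k t) ∧ MemLp (k t) 2 ((pinnedChain ω₂ lam β γ).gibbsMeasure N T)) ∧
    (∀ s t : ℝ, 0 ≤ s → 0 ≤ t → ∀ z : PhaseSpace N,
      ∫ y, k t y ∂((pinnedChain ω₂ lam β γ).transitionKernel N T T s.toNNReal z) = k (s + t) z - k s z) := by
  set P := pinnedChain ω₂ lam β γ with hP
  set κ := P.transitionKernel N T T with hκ
  set H := P.hamiltonian N with hH
  set μ := P.gibbsMeasure N T with hμ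
  haveI hMk : ∀ t, IsMarkovKernel (κ t) := fun t =>
    pinnedChain_isMarkovKernel_transitionKernel hω hl hβ.le hγ.le N T T t
  haveI : IsProbabilityMeasure μ := pinnedChain_isProbabilityMeasure_gibbsMeasure hω hl hβ.le γ N hT
  have hϑ1 : ϑ < 1 / T := by linarith
  have hPg_apply : ∀ s z, Pg s z = ∫ y, g y ∂(κ s.toNNReal z) := fun s z => by rw [hPg]
  have hk_apply : ∀ τ z, k τ z = ∫ s in (0 : ℝ)..τ, Pg s z := fun τ z => by rw [hk]
  -- continuity in time
  have hcont : ∀ z, Continuous fun s => Pg s z := fun z => by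
    rw [hPg]; exact pinnedChain_continuous_act_time_of_exp hω hl hβ hγ hN hT hϑ h2ϑ hM hg hgM z
  -- the uniform bound
  obtain ⟨C, hC0, hC⟩ := pinnedChain_exists_act_bound hω hl hβ hγ hN hT hϑ hϑ1 hM hg hgM
  have hPgb : ∀ s z, |Pg s z| ≤ C * Real.exp (ϑ * H z) := fun s z => by rw [hPg_apply]; exact hC _ z
  have hkb : ∀ t : ℝ, 0 ≤ t → ∀ z, |k t z| ≤ t * C * Real.exp (ϑ * H z) := by
    intro t ht z
    rw [hk_apply, intervalIntegral.integral_of_le ht, ← Real.norm_eq_abs]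
    have h1 := norm_setIntegral_le_of_norm_le_const (measure_Ioc_lt_top (μ := (volume : Measure ℝ))
      (a := (0 : ℝ)) (b := t))
      (fun s _ => show ‖Pg s z‖ ≤ C * Real.exp (ϑ * H z) by rw [Real.norm_eq_abs]; exact hPgb s z)
    rw [Real.volume_real_Ioc_of_le ht, sub_zero] at h1
    calc _ ≤ C * Real.exp (ϑ * H z) * t := h1
      _ = t * C * Real.exp (ϑ * H z) := by ring
  -- joint measurability
  have hSM : StronglyMeasurable (Function.uncurry Pg) := by
    have h := ((pinnedChainSemigroup hω hl hβ.le hγ.le hN hT.le hT.le).stronglyMeasurable_uncurry_act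
      hg.stronglyMeasurable).comp_measurable measurable_swap
    rw [hPg]
    exact h
  have hkSM : ∀ t : ℝ, 0 ≤ t → StronglyMeasurable (k t) := by
    intro t ht
    have hkt : k t = fun z => ∫ s in Ioc (0 : ℝ) t, Pg s z := by
      funext z; rw [hk_apply, intervalIntegral.integral_of_le ht]
    rw [hkt]
    exact StronglyMeasurable.integral_prod_left' (μ := volume.restrict (Ioc (0 : ℝ) t)) hSM
  -- `L²(μ_T)` through the weight `e^{ϑH}`
  have hHc : Continuous H := pinnedChain_continuous_hamiltonian ω₂ lam β γ N
  have hVc : Continuous fun z => Real.exp (ϑ * H z) := Real.continuous_exp.comp (continuous_const.mul hHc)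
  have hexp2 : MemLp (fun z => Real.exp (ϑ * H z)) 2 μ := by
    rw [memLp_two_iff_integrable_sq hVc.aestronglyMeasurable]
    have h := pinnedChain_integrable_exp_mul_hamiltonian_gibbsMeasure hω hl hβ.le γ N hT h2ϑ
    refine h.congr (Eventually.of_forall fun z => ?_)
    change Real.exp (2 * ϑ * H z) = Real.exp (ϑ * H z) ^ 2
    rw [sq, ← Real.exp_add]; congr 1; ring
  have hkL2 : ∀ t : ℝ, 0 ≤ t → MemLp (k t) 2 μ := fun t ht =>
    hexp2.of_le_mul (c := t * C) (hkSM t ht).aestronglyMeasurable (Eventually.of_forall fun z => by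
      rw [Real.norm_eq_abs, Real.norm_eq_abs, abs_of_pos (Real.exp_pos _)]; exact hkb t ht z)
  -- `g` is integrable for the kernels; Chapman–Kolmogorov
  have hVint : ∀ (t : ℝ≥0) (z : PhaseSpace N), Integrable (fun y => Real.exp (ϑ * H y)) (κ t z) := fun t z =>
    pinnedChain_integrable_exp_mul_hamiltonian_transitionKernel hω hl hT hβ.le hγ.le hN hϑ hϑ1 t z
  have hgint : ∀ (t : ℝ≥0) (z : PhaseSpace N), Integrable g (κ t z) := fun t z =>
    integrable_of_abs_le_exp (hVint t z) hg hgM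
  have hCK : ∀ u s : ℝ, 0 ≤ u → 0 ≤ s → ∀ z : PhaseSpace N,
      Pg (u + s) z = ∫ x, Pg u x ∂(κ s.toNNReal z) := by
    intro u s hu hs z
    have hadd : κ (u + s).toNNReal = κ u.toNNReal ∘ₖ κ s.toNNReal := by
      rw [Real.toNNReal_add hu hs, add_comm, hκ, pinnedChain_transitionKernel_add hω hl hβ.le hγ.le N T T]
    rw [hPg_apply, hadd]
    simp_rw [hPg_apply]
    exact Kernel.integral_comp (by rw [← hadd]; exact hgint _ z)
  refine ⟨hcont, ⟨C, hC0, hPgb, hkb⟩, hSM, fun t ht => ⟨hkSM t ht, hkL2 t ht⟩, ?_⟩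
  -- the semigroup identity
  intro s t hs ht z
  have hint : ∀ a b : ℝ, IntervalIntegrable (fun r => Pg r z) volume a b := fun a b =>
    (hcont z).intervalIntegrable a b
  -- Fubini on `(0,t] × P_s(z, ·)`
  have hprod : Integrable (Function.uncurry Pg) ((volume.restrict (Ioc (0 : ℝ) t)).prod (κ s.toNNReal z)) := by
    haveI : IsFiniteMeasure (volume.restrict (Ioc (0 : ℝ) t)) := ⟨by
      rw [Measure.restrict_apply_univ]; exact measure_Ioc_lt_top⟩
    refine Integrable.mono'
      ((Integrable.mul_prod (integrable_const (1 : ℝ)) (hVint s.toNNReal z)).const_mul C)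
      hSM.aestronglyMeasurable (Eventually.of_forall fun p => ?_)
    calc ‖Function.uncurry Pg p‖ = |Pg p.1 p.2| := rfl
      _ ≤ C * Real.exp (ϑ * H p.2) := hPgb p.1 p.2
      _ = C * (1 * Real.exp (ϑ * H p.2)) := by ring
  have hswap : ∫ y, k t y ∂(κ s.toNNReal z) = ∫ u in Ioc (0 : ℝ) t, ∫ y, Pg u y ∂(κ s.toNNReal z) := by
    have e : (fun y => k t y) = fun y => ∫ u in Ioc (0 : ℝ) t, Pg u y := by
      funext y; rw [hk_apply, intervalIntegral.integral_of_le ht]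
    rw [e]; exact (integral_integral_swap hprod).symm
  rw [hswap]
  have h2 : ∫ u in Ioc (0 : ℝ) t, ∫ y, Pg u y ∂(κ s.toNNReal z) = ∫ u in Ioc (0 : ℝ) t, Pg (u + s) z :=
    setIntegral_congr_fun measurableSet_Ioc fun u hu => (hCK u s hu.1.le hs z).symm
  rw [h2, ← intervalIntegral.integral_of_le ht, intervalIntegral.integral_comp_add_right (fun r => Pg r z) s,
    zero_add, hk_apply, hk_apply, add_comm s t]
  rw [← intervalIntegral.integral_add_adjacent_intervals (hint 0 s) (hint s (t + s))]; ring

end Pinned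

/-- **Registered sub-goal `pinnedChain_actWindowKinetics`** of crux stmt-AtomisticToContinuum-9121 (under
`stub_clausiusBudget`): the kinetics package `pinnedChain_act_window` in closed form.
[cite: CuneoEckmannHairerReyBellet2018, §3 eq. (3.4)] -/
theorem pinnedChain_actWindowKinetics : ∀ ω₂ lam β γ : ℝ, 0 < ω₂ → 0 ≤ lam → 0 < β → 0 < γ → ∀ (N : ℕ), 0 < N → ∀ T : ℝ, 0 < T → ∀ ϑ M : ℝ, 0 < ϑ → 2 * ϑ < 1 / T → 0 ≤ M → ∀ g : PhaseSpace N → ℝ, Continuous g → (∀ y, |g y| ≤ M * Real.exp (ϑ * (pinnedChain ω₂ lam β γ).hamiltonian N y)) → ∀ Pg : ℝ → PhaseSpace N → ℝ, Pg = (fun s z => ∫ y, g y ∂((pinnedChain ω₂ lam β γ).transitionKernel N T T s.toNNReal z)) → ∀ k : ℝ → PhaseSpace N → ℝ, k = (fun τ z => ∫ s in (0 : ℝ)..τ, Pg s z) → (∀ z, Continuous fun s => Pg s z) ∧ (∃ C : ℝ, 0 ≤ C ∧ (∀ s z, |Pg s z| ≤ C * Real.exp (ϑ * (pinnedChain ω₂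 lam β γ).hamiltonian N z)) ∧ ∀ t : ℝ, 0 ≤ t → ∀ z, |k t z| ≤ t * C * Real.exp (ϑ * (pinnedChain ω₂ lam β γ).hamiltonian N z)) ∧ StronglyMeasurable (Function.uncurry Pg) ∧ (∀ t : ℝ, 0 ≤ t → StronglyMeasurable (k t) ∧ MemLp (k t) 2 ((pinnedChain ω₂ lam β γ).gibbsMeasure N T)) ∧ (∀ s t : ℝ, 0 ≤ s → 0 ≤ t → ∀ z : PhaseSpace N, ∫ y, k t y ∂((pinnedChain ω₂ lam β γ).transitionKernel N T T s.toNNReal z) = k (s + t) z - k s z) :=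
  fun _ _ _ _ hω hl hβ hγ _ hN _ hT _ _ hϑ h2ϑ hM _ hg hgM Pg hPg k hk =>
    pinnedChain_act_window hω hl hβ hγ hN hT hϑ h2ϑ hM hg hgM Pg hPg k hk

end Summit.AtomisticToContinuum.FouriersLaw.Theorems.ExtensiveSnapshotIrreversibility.ClausiusBudget

end
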